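import Mathlib
import Literature.NumberTheory.Automorphic.HilbertModularFormQExpansion
import Summits.Langlands.Langlands.Theorems.CapacityClassicalityHilbertIntegralOverconvergentIsCongruenceQExpansionDictionary
import Summits.Langlands.Langlands.Theorems.CapacityClassicalityHilbertIntegralOverconvergentIsCongruenceStubModularFormCoeffSupport
import Summits.Langlands.Langlands.Theorems.CapacityClassicalityHilbertIntegralOverconvergentIsCongruenceStubFourierCoeffLinear
import Summits.Langlands.Langlands.Theorems.CapacityClassicalityHilbertIntegralOverconvergentIsCongruenceStubQExpansionInjective
import Summits.Langlands.Langlands.Theorems.CapacityClassicalityHilbertIntegralOverconvergentIsCongruenceStubIndicatorModularForm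
import Summits.Langlands.Langlands.Theorems.CapacityClassicalityHilbertIntegralOverconvergentIsCongruenceStubModularFormPeriodic

/-!
# The `q`-expansion principle over `ℂ` for Hilbert modular forms: the graded algebra `⊕_b M_b(Γ₁(𝔫))` embeds into
# `MvPowerSeries (Fin d) ℂ` along the encoded `q`-expansion (section P endpoint)

Endpoint of RESHAPE 12 (section P) of line Sketch-ideate-r1-k1 for the crux `HilbertIntegralOverconvergentIsCongruence`
(stmt-Langlands-8485): `hilbertQExpansionRing` — for `F` totally real, `[F:ℚ] ≥ 2`, `𝔫 ≠ 0`, there are an encoding `idx` of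
the cone `qIndexSet F` into `ℕ^d` and a map `enc` to `MvPowerSeries (Fin d) ℂ` which encodes the `q`-expansion of every function,
and ON HILBERT MODULAR FORMS OF LEVEL `Γ₁(𝔫)` is multiplicative (`qExpansionDictionary` + cone support by Koecher,
`stub_modularForm_coeff_support`, + periodicity `stub_modularForm_periodic`), additive and `ℂ`-homogeneous
(`stub_fourierCoeff_linear`), sends the unit form `1_ℍ` of weight `0` to `1` (`stub_indicator_modularForm`), and is INJECTIVE
(`stub_qExpansion_injective`, Freitag I.4.1).  This is the family-axiom half of the engine instance over `ℂ`
(`V b = enc '' M_b` is closed under products and sums, contains `1` at `b = 0`, and `enc` loses nothing).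
-/

set_option linter.dupNamespace false

noncomputable section

namespace Summit.Langlands.Langlands.Theorems.HilbertIntegralOverconvergentIsCongruence

open MeasureTheory Complex NumberField
open Literature.NumberTheory.Automorphic Literature.NumberTheory.Automorphic.HilbertModular
open scoped MatrixGroups

/-- **The `q`-expansion principle over `ℂ` for Hilbert modular forms**: see the module docstring.
[cite: Freitag1990, Ch. I Lemma 4.1] -/
theorem hilbertQExpansionRing (F : Type) [Field F] [NumberField F] [NumberField.IsTotallyReal F]
    (hd : 1 < Module.finrank ℚ F) (𝔫 : Ideal (𝓞 F)) (h𝔫 : 𝔫 ≠ ⊥) :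
    ∃ (d : ℕ) (idx : F → (Fin d →₀ ℕ)) (enc : (Point F → ℂ) → MvPowerSeries (Fin d) ℂ),
      Set.InjOn idx (qIndexSet F) ∧ (∀ μ ∈ qIndexSet F, ∀ μ' ∈ qIndexSet F, idx (μ + μ') = idx μ + idx μ') ∧
      (∀ f : Point F → ℂ, (∀ μ ∈ qIndexSet F, MvPowerSeries.coeff (idx μ) (enc f) = fourierCoeff f μ) ∧
          ∀ n, (∀ μ ∈ qIndexSet F, idx μ ≠ n) → MvPowerSeries.coeff n (enc f) = 0) ∧
      (∀ (k k' : (F →+* ℝ) → ℤ) (f g : Point F → ℂ), f ∈ modularForms (Bianchi.Gamma1 𝔫) k →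
          g ∈ modularForms (Bianchi.Gamma1 𝔫) k' → enc (f * g) = enc f * enc g) ∧
      (∀ (k : (F →+* ℝ) → ℤ) (f g : Point F → ℂ), f ∈ modularForms (Bianchi.Gamma1 𝔫) k →
          g ∈ modularForms (Bianchi.Gamma1 𝔫) k → enc (f + g) = enc f + enc g) ∧
      (∀ (k : (F →+* ℝ) → ℤ) (c : ℂ) (f : Point F → ℂ), f ∈ modularForms (Bianchi.Gamma1 𝔫) k →
          enc (c • f) = c • enc f) ∧
      ((halfSpace F).indicator (fun _ ↦ (1 : ℂ)) ∈ modularForms (Bianchi.Gamma1 𝔫) 0 ∧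
          enc ((halfSpace F).indicator (fun _ ↦ (1 : ℂ))) = 1) ∧
      ∀ (k k' : (F →+* ℝ) → ℤ) (f g : Point F → ℂ), f ∈ modularForms (Bianchi.Gamma1 𝔫) k →
          g ∈ modularForms (Bianchi.Gamma1 𝔫) k' → enc f = enc g → f = g := by
  classical
  obtain ⟨d, idx, hinj, hadd, hdict⟩ := qExpansionDictionary F
  -- the encoding of a coefficient function
  let enc : (Point F → ℂ) → MvPowerSeries (Fin d) ℂ := fun f n ↦
    if h : ∃ μ ∈ qIndexSet F, idx μ = n then fourierCoeff f h.choose else 0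
  have enc_coeff : ∀ (f : Point F → ℂ) (n : Fin d →₀ ℕ), MvPowerSeries.coeff n (enc f) =
      if h : ∃ μ ∈ qIndexSet F, idx μ = n then fourierCoeff f h.choose else 0 := fun _ _ ↦ rfl
  have henc : ∀ f : Point F → ℂ, (∀ μ ∈ qIndexSet F, MvPowerSeries.coeff (idx μ) (enc f) = fourierCoeff f μ) ∧
      ∀ n, (∀ μ ∈ qIndexSet F, idx μ ≠ n) → MvPowerSeries.coeff n (enc f) = 0 := by
    intro f
    refine ⟨fun μ hμ ↦ ?_, fun n hn ↦ ?_⟩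
    · have hex : ∃ μ' ∈ qIndexSet F, idx μ' = idx μ := ⟨μ, hμ, rfl⟩
      rw [enc_coeff, dif_pos hex]
      congr 1
      exact hinj hex.choose_spec.1 hμ hex.choose_spec.2
    · have hex : ¬ ∃ μ' ∈ qIndexSet F, idx μ' = n := fun ⟨μ', hμ', h⟩ ↦ hn μ' hμ' h
      rw [enc_coeff, dif_neg hex]
  -- coefficientwise description of `enc` from linear data on the cone
  have enc_ext : ∀ (f : Point F → ℂ) (Q : MvPowerSeries (Fin d) ℂ),
      (∀ μ ∈ qIndexSet F, MvPowerSeries.coeff (idx μ) Q = fourierCoeff f μ) →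
      (∀ n, (∀ μ ∈ qIndexSet F, idx μ ≠ n) → MvPowerSeries.coeff n Q = 0) → enc f = Q := by
    intro f Q hQ hQ0
    ext n
    by_cases hn : ∃ μ ∈ qIndexSet F, idx μ = n
    · obtain ⟨μ, hμ, rfl⟩ := hn
      rw [(henc f).1 μ hμ, hQ μ hμ]
    · push Not at hn
      rw [(henc f).2 n hn, hQ0 n hn]
  have hol : ∀ {k : (F →+* ℝ) → ℤ} {f : Point F → ℂ}, f ∈ modularForms (Bianchi.Gamma1 𝔫) k → IsHolomorphicOn F f :=
    fun hf ↦ hf.holomorphic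
  have cont : ∀ {k : (F →+* ℝ) → ℤ} {f : Point F → ℂ}, f ∈ modularForms (Bianchi.Gamma1 𝔫) k → ContinuousOn f (halfSpace F) :=
    fun hf ↦ hf.holomorphic.continuousOn
  refine ⟨d, idx, enc, hinj, hadd, henc, ?_, ?_, ?_, ?_, ?_⟩
  · -- multiplicativity
    intro k k' f g hf hg
    exact (hdict f g (hol hf) (hol hg) (stub_modularForm_periodic F 𝔫 k f hf) (stub_modularForm_periodic F 𝔫 k' g hg)
      (fun μ hμ hμc ↦ stub_modularForm_coeff_support F hd 𝔫 h𝔫 k f hf μ hμ hμc) (fun μ hμ hμc ↦ stub_modularForm_coeff_support F hd 𝔫 h𝔫 k' g hg μ hμ hμc)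
      (enc f) (enc g) (enc (f * g)) (henc f) (henc g) (henc (f * g)))
  · -- additivity
    intro k f g hf hg
    refine enc_ext (f + g) (enc f + enc g) (fun μ hμ ↦ ?_) (fun n hn ↦ ?_)
    · rw [map_add, (henc f).1 μ hμ, (henc g).1 μ hμ, fourierCoeff_eq, fourierCoeff_eq, fourierCoeff_eq]
      exact ((stub_fourierCoeff_linear F f g (cont hf) (cont hg) 1 μ (fun _ ↦ 1) fun _ ↦ one_pos).1).symm
    · rw [map_add, (henc f).2 n hn, (henc g).2 n hn, add_zero]
  · -- homogeneity
    intro k c f hf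
    refine enc_ext (c • f) (c • enc f) (fun μ hμ ↦ ?_) (fun n hn ↦ ?_)
    · rw [map_smul, (henc f).1 μ hμ, smul_eq_mul, fourierCoeff_eq, fourierCoeff_eq]
      exact ((stub_fourierCoeff_linear F f f (cont hf) (cont hf) c μ (fun _ ↦ 1) fun _ ↦ one_pos).2.1).symm
    · rw [map_smul, (henc f).2 n hn, smul_zero]
  · -- the unit form
    obtain ⟨hmem, h0, hne⟩ := stub_indicator_modularForm F (Bianchi.Gamma1 𝔫)
    refine ⟨hmem, enc_ext _ 1 (fun μ hμ ↦ ?_) (fun n hn ↦ ?_)⟩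
    · have hidx0 : idx 0 = 0 := by
        have h := hadd 0 zero_mem_qIndexSet 0 zero_mem_qIndexSet
        rw [add_zero] at h
        exact left_eq_add.1 h
      rw [MvPowerSeries.coeff_one]
      by_cases hμ0 : μ = 0
      · subst hμ0
        rw [if_pos hidx0, h0]
      · have : idx μ ≠ 0 := fun h ↦ hμ0 (hinj hμ zero_mem_qIndexSet (h.trans hidx0.symm))
        rw [if_neg this, hne μ hμ.1 hμ0]
    · rw [MvPowerSeries.coeff_one, if_neg]
      intro h0n
      have hidx0 : idx 0 = 0 := by
        have h := hadd 0 zero_mem_qIndexSet 0 zero_mem_qIndexSet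
        rw [add_zero] at h
        exact left_eq_add.1 h
      exact hn 0 zero_mem_qIndexSet (hidx0.trans h0n.symm)
  · -- injectivity
    intro k k' f g hf hg hfg
    have hcoef : ∀ μ : F, (∀ a : 𝓞 F, ∃ n : ℤ, Algebra.trace ℚ F (μ * a) = n) → fourierCoeff f μ = fourierCoeff g μ := by
      intro μ hμ
      by_cases hμc : μ ∈ qIndexSet F
      · rw [← (henc f).1 μ hμc, ← (henc g).1 μ hμc, hfg]
      · rw [stub_modularForm_coeff_support F hd 𝔫 h𝔫 k f hf μ hμ hμc, stub_modularForm_coeff_support F hd 𝔫 h𝔫 k' g hg μ hμ hμc]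
    have hℍ := stub_qExpansion_injective F f g (hol hf) (hol hg) (stub_modularForm_periodic F 𝔫 k f hf) (stub_modularForm_periodic F 𝔫 k' g hg) hcoef
    funext z
    by_cases hz : z ∈ halfSpace F
    · exact hℍ z hz
    · rw [hf.eq_zero z hz, hg.eq_zero z hz]

end Summit.Langlands.Langlands.Theorems.HilbertIntegralOverconvergentIsCongruence
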